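import Literature.NumberTheory.Transcendental.MultipleZetaShuffleProofs
import HarnessLib

/-!
# Multiple zeta values — Euler's decomposition theorem (the shuffle product in depth `1 × 1`)

Sibling proof file of `Literature.NumberTheory.Transcendental.MultipleZeta` (theorems only: no
definition, no statement change, no named fact), continuing `MultipleZetaShuffleProofs.lean`,
which proved the instances `ζ(2)ζ(3)`, `ζ(2)²`, `ζ(2)ζ(4)`, `ζ(3)²`. Here the general statement,
**Euler's decomposition theorem** (Eie 2013, Theorem 1.2.3: for positive `p, q`,
`ζ(p+1)ζ(q+1) = ∑_{|α| = p+q+1} (binom(α₂, q) + binom(α₂, p)) ζ(α₁, α₂ + 1)` in the increasing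
convention): for `a, b ≥ 2`, in the decreasing convention of `multipleZeta`,

  `ζ(a) ζ(b) = ∑_{i < a} binom(b+i-1, i) ζ(b+i, a-i) + ∑_{j < b} binom(a+j-1, j) ζ(a+j, b-j)`

(`multipleZeta_mul_eq_euler_decomposition`), i.e. the shuffle product `0^{a-1}1 ш 0^{b-1}1`
counted with binomial multiplicities.

## Proof

Euler's partial fractions, organised (as in `MultipleZetaShuffleProofs.lean`) as the reduction of
Tornheim's double series `W(a,b,c) = ∑_{m,n ≥ 1} m^{-a} n^{-b} (m+n)^{-c}` in `ℝ≥0∞`: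
`W(a+1,b+1,c) = W(a,b+1,c+1) + W(a+1,b,c+1)` (`tsum_tornheim_succ_succ`). By induction on `a + b`
(`tsum_tornheim_eq_sum_binomial`), for `a + b ≥ 1`,
`W(a,b,c) = ∑_{i<a} binom(b+i-1, i) W(a-i, 0, c+b+i) + ∑_{j<b} binom(a+j-1, j) W(0, b-j, c+a+j)`,
the induction step being Pascal's rule; the boundary values are `W(x,0,c) = W(0,x,c) = ζ(c,x)`
and `W(a,b,0) = ζ(a)ζ(b)` (`tsum_tornheim_zero_right/left/zero`).

## References

* M. Eie, *The Theory of Multiple Zeta Values with Applications in Combinatorics*, World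
  Scientific (2013), §1.2, Theorem 1.2.3 (Euler's decomposition theorem). [Eie2013]
* J. M. Borwein, D. M. Bradley, *Thirty-two Goldbach variations*, Int. J. Number Theory 2 (2006),
  65–103, §2 (partial fractions). [BorweinBradley2006]
-/

noncomputable section

open scoped BigOperators ENNReal

namespace Literature.NumberTheory.Transcendental

/-! ### Tornheim's double series as a binomial sum of its boundary values -/

/-- **`W(a,b,c)` in terms of boundary values**: for `a + b ≥ 1`,
`W(a,b,c) = ∑_{i<a} binom(b+i-1, i) W(a-i,0,c+b+i) + ∑_{j<b} binom(a+j-1, j) W(0,b-j,c+a+j)`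
(all in `ℝ≥0∞`, product coordinates), by induction on `a + b` from the reduction
`W(a+1,b+1,c) = W(a,b+1,c+1) + W(a+1,b,c+1)` and Pascal's rule. (With natural-number subtraction
the cases `a = 0` or `b = 0` read `W = W`.) [cite: Eie2013, Theorem 1.2.3] -/
theorem tsum_tornheim_eq_sum_binomial : ∀ (n a b c : ℕ), a + b = n → 1 ≤ a + b →
    ∑' p : ℕ × ℕ, ENNReal.ofReal
        (1 / (((p.1 : ℝ) + 1) ^ a * ((p.2 : ℝ) + 1) ^ b * ((p.1 : ℝ) + p.2 + 2) ^ c)) =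
      (∑ i ∈ Finset.range a, (Nat.choose (b + i - 1) i : ℝ≥0∞) *
        ∑' p : ℕ × ℕ, ENNReal.ofReal
          (1 / (((p.1 : ℝ) + 1) ^ (a - i) * ((p.2 : ℝ) + 1) ^ 0 * ((p.1 : ℝ) + p.2 + 2) ^ (c + b + i)))) +
      ∑ j ∈ Finset.range b, (Nat.choose (a + j - 1) j : ℝ≥0∞) *
        ∑' p : ℕ × ℕ, ENNReal.ofReal
          (1 / (((p.1 : ℝ) + 1) ^ 0 * ((p.2 : ℝ) + 1) ^ (b - j) * ((p.1 : ℝ) + p.2 + 2) ^ (c + a + j))) := by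
  intro n
  induction n with
  | zero => intro a b c hab h1; omega
  | succ n ih =>
    intro a b c hab h1
    rcases Nat.eq_zero_or_pos a with rfl | ha
    · -- `a = 0`: only the term `j = 0` of the second sum survives
      rw [Finset.sum_range_zero, zero_add]
      have hb : b ≠ 0 := by omega
      rw [Finset.sum_eq_single_of_mem 0 (Finset.mem_range.2 (Nat.pos_of_ne_zero hb))]
      · simp
      · intro j _ hj
        rw [show (0 : ℕ) + j - 1 = j - 1 by omega, Nat.choose_eq_zero_of_lt (by omega)]
        simp
    rcases Nat.eq_zero_or_pos b with rfl | hb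
    · -- `b = 0`: only the term `i = 0` of the first sum survives
      rw [Finset.sum_range_zero, add_zero]
      rw [Finset.sum_eq_single_of_mem 0 (Finset.mem_range.2 ha)]
      · simp
      · intro i _ hi
        rw [show (0 : ℕ) + i - 1 = i - 1 by omega, Nat.choose_eq_zero_of_lt (by omega)]
        simp
    -- `a = a' + 1`, `b = b' + 1`
    obtain ⟨a', rfl⟩ : ∃ a', a = a' + 1 := ⟨a - 1, by omega⟩
    obtain ⟨b', rfl⟩ : ∃ b', b = b' + 1 := ⟨b - 1, by omega⟩
    have IH1 := ih a' (b' + 1) (c + 1) (by omega) (by omega)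
    have IH2 := ih (a' + 1) b' (c + 1) (by omega) (by omega)
    rw [tsum_tornheim_succ_succ a' b' c, IH1, IH2]
    -- abbreviations for the boundary values
    set X : ℕ → ℕ → ℝ≥0∞ := fun x e => ∑' p : ℕ × ℕ, ENNReal.ofReal
      (1 / (((p.1 : ℝ) + 1) ^ x * ((p.2 : ℝ) + 1) ^ 0 * ((p.1 : ℝ) + p.2 + 2) ^ e)) with hX
    set Y : ℕ → ℕ → ℝ≥0∞ := fun y e => ∑' p : ℕ × ℕ, ENNReal.ofReal
      (1 / (((p.1 : ℝ) + 1) ^ 0 * ((p.2 : ℝ) + 1) ^ y * ((p.1 : ℝ) + p.2 + 2) ^ e)) with hY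
    -- normalise the index arithmetic inside the four sums of the two induction hypotheses and
    -- the two sums of the goal
    have e1 : ∑ i ∈ Finset.range a', (Nat.choose (b' + 1 + i - 1) i : ℝ≥0∞) *
        X (a' - i) (c + 1 + (b' + 1) + i) =
        ∑ i ∈ Finset.range a', (Nat.choose (b' + i) i : ℝ≥0∞) * X (a' - i) (c + b' + 2 + i) :=
      Finset.sum_congr rfl fun i _ => by
        rw [show b' + 1 + i - 1 = b' + i by omega, show c + 1 + (b' + 1) + i = c + b' + 2 + i by ring]
    have e2 : ∑ j ∈ Finset.range (b' + 1), (Nat.choose (a' + j - 1) j : ℝ≥0∞) *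
        Y (b' + 1 - j) (c + 1 + a' + j) =
        Y (b' + 1) (c + a' + 1) + ∑ j ∈ Finset.range b', (Nat.choose (a' + j) (j + 1) : ℝ≥0∞) *
          Y (b' - j) (c + a' + 2 + j) := by
      rw [Finset.sum_range_succ', add_comm]
      congr 1
      · simp [show c + 1 + a' + 0 = c + a' + 1 by ring]
      · refine Finset.sum_congr rfl fun j _ => ?_
        rw [show a' + (j + 1) - 1 = a' + j by omega, show b' + 1 - (j + 1) = b' - j by omega,
          show c + 1 + a' + (j + 1) = c + a' + 2 + j by ring]
    have e3 : ∑ i ∈ Finset.range (a' + 1), (Nat.choose (b' + i - 1) i : ℝ≥0∞) *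
        X (a' + 1 - i) (c + 1 + b' + i) =
        X (a' + 1) (c + b' + 1) + ∑ i ∈ Finset.range a', (Nat.choose (b' + i) (i + 1) : ℝ≥0∞) *
          X (a' - i) (c + b' + 2 + i) := by
      rw [Finset.sum_range_succ', add_comm]
      congr 1
      · simp [show c + 1 + b' + 0 = c + b' + 1 by ring]
      · refine Finset.sum_congr rfl fun i _ => ?_
        rw [show b' + (i + 1) - 1 = b' + i by omega, show a' + 1 - (i + 1) = a' - i by omega,
          show c + 1 + b' + (i + 1) = c + b' + 2 + i by ring]
    have e4 : ∑ j ∈ Finset.range b', (Nat.choose (a' + 1 + j - 1) j : ℝ≥0∞) *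
        Y (b' - j) (c + 1 + (a' + 1) + j) =
        ∑ j ∈ Finset.range b', (Nat.choose (a' + j) j : ℝ≥0∞) * Y (b' - j) (c + a' + 2 + j) :=
      Finset.sum_congr rfl fun j _ => by
        rw [show a' + 1 + j - 1 = a' + j by omega, show c + 1 + (a' + 1) + j = c + a' + 2 + j by ring]
    -- the goal's sums
    have g1 : ∑ i ∈ Finset.range (a' + 1), (Nat.choose (b' + 1 + i - 1) i : ℝ≥0∞) *
        X (a' + 1 - i) (c + (b' + 1) + i) =
        X (a' + 1) (c + b' + 1) + ∑ i ∈ Finset.range a', ((Nat.choose (b' + i) i : ℝ≥0∞) +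
          (Nat.choose (b' + i) (i + 1) : ℝ≥0∞)) * X (a' - i) (c + b' + 2 + i) := by
      rw [Finset.sum_range_succ', add_comm]
      congr 1
      · simp [show c + (b' + 1) + 0 = c + b' + 1 by ring]
      · refine Finset.sum_congr rfl fun i _ => ?_
        rw [show b' + 1 + (i + 1) - 1 = (b' + i) + 1 by omega, Nat.choose_succ_succ', Nat.cast_add,
          add_comm ((Nat.choose (b' + i) i : ℕ) : ℝ≥0∞), show a' + 1 - (i + 1) = a' - i by omega,
          show c + (b' + 1) + (i + 1) = c + b' + 2 + i by ring, add_comm]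
    have g2 : ∑ j ∈ Finset.range (b' + 1), (Nat.choose (a' + 1 + j - 1) j : ℝ≥0∞) *
        Y (b' + 1 - j) (c + (a' + 1) + j) =
        Y (b' + 1) (c + a' + 1) + ∑ j ∈ Finset.range b', ((Nat.choose (a' + j) j : ℝ≥0∞) +
          (Nat.choose (a' + j) (j + 1) : ℝ≥0∞)) * Y (b' - j) (c + a' + 2 + j) := by
      rw [Finset.sum_range_succ', add_comm]
      congr 1
      · simp [show c + (a' + 1) + 0 = c + a' + 1 by ring]
      · refine Finset.sum_congr rfl fun j _ => ?_
        rw [show a' + 1 + (j + 1) - 1 = (a' + j) + 1 by omega, Nat.choose_succ_succ', Nat.cast_add,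
          add_comm ((Nat.choose (a' + j) j : ℕ) : ℝ≥0∞), show b' + 1 - (j + 1) = b' - j by omega,
          show c + (a' + 1) + (j + 1) = c + a' + 2 + j by ring, add_comm]
    rw [e1, e2, e3, e4, g1, g2]
    simp only [add_mul, Finset.sum_add_distrib]
    ring

/-! ### Euler's decomposition theorem -/

/-- **Euler's decomposition theorem** (the shuffle product of two single zeta values; Eie 2013,
Theorem 1.2.3: `ζ(p+1)ζ(q+1) = ∑_{|α|=p+q+1} (binom(α₂,q) + binom(α₂,p)) ζ(α₁, α₂+1)` in the
increasing convention). In the decreasing convention of `multipleZeta`: for `a, b ≥ 2`,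
`ζ(a)ζ(b) = ∑_{i<a} binom(b+i-1, i) ζ(b+i, a-i) + ∑_{j<b} binom(a+j-1, j) ζ(a+j, b-j)`.
E.g. `a = 2, b = 3`: `ζ(2)ζ(3) = ζ(3,2) + 3ζ(4,1) + ζ(2,3) + 2ζ(3,2) + 3ζ(4,1)`.
[cite: Eie2013, Theorem 1.2.3] -/
theorem multipleZeta_mul_eq_euler_decomposition {a b : ℕ} (ha : 2 ≤ a) (hb : 2 ≤ b) :
    multipleZeta [a] * multipleZeta [b] =
      (∑ i ∈ Finset.range a, (Nat.choose (b + i - 1) i : ℝ) * multipleZeta [b + i, a - i]) +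
        ∑ j ∈ Finset.range b, (Nat.choose (a + j - 1) j : ℝ) * multipleZeta [a + j, b - j] := by
  -- boundary values
  have hX : ∀ i ∈ Finset.range a, ∑' p : ℕ × ℕ, ENNReal.ofReal
      (1 / (((p.1 : ℝ) + 1) ^ (a - i) * ((p.2 : ℝ) + 1) ^ 0 * ((p.1 : ℝ) + p.2 + 2) ^ (0 + b + i))) =
      ENNReal.ofReal (multipleZeta [b + i, a - i]) := fun i hi => by
    have hi' := Finset.mem_range.1 hi
    rw [zero_add]
    exact tsum_tornheim_zero_right (by omega) (by omega)
  have hY : ∀ j ∈ Finset.range b, ∑' p : ℕ × ℕ, ENNReal.ofReal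
      (1 / (((p.1 : ℝ) + 1) ^ 0 * ((p.2 : ℝ) + 1) ^ (b - j) * ((p.1 : ℝ) + p.2 + 2) ^ (0 + a + j))) =
      ENNReal.ofReal (multipleZeta [a + j, b - j]) := fun j hj => by
    have hj' := Finset.mem_range.1 hj
    rw [zero_add]
    exact tsum_tornheim_zero_left (by omega) (by omega)
  -- the identity in `ℝ≥0∞`
  have key : ENNReal.ofReal (multipleZeta [a]) * ENNReal.ofReal (multipleZeta [b]) =
      (∑ i ∈ Finset.range a, (Nat.choose (b + i - 1) i : ℝ≥0∞) *
        ENNReal.ofReal (multipleZeta [b + i, a - i])) +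
      ∑ j ∈ Finset.range b, (Nat.choose (a + j - 1) j : ℝ≥0∞) *
        ENNReal.ofReal (multipleZeta [a + j, b - j]) := by
    rw [← tsum_tornheim_zero_zero ha hb, tsum_tornheim_eq_sum_binomial (a + b) a b 0 rfl (by omega)]
    congr 1
    · exact Finset.sum_congr rfl fun i hi => by rw [hX i hi]
    · exact Finset.sum_congr rfl fun j hj => by rw [hY j hj]
  -- everything is `ofReal` of a nonnegative real
  have hpa := (multipleZeta_pos_of_isAdmissible_holds (MZV.isAdmissible_singleton_of_two_le ha)).le
  have hpb := (multipleZeta_pos_of_isAdmissible_holds (MZV.isAdmissible_singleton_of_two_le hb)).le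
  have hz1 : ∀ i ∈ Finset.range a, 0 ≤ multipleZeta [b + i, a - i] := fun i hi => by
    have hi' := Finset.mem_range.1 hi
    exact (multipleZeta_pos_of_isAdmissible_holds (MZV.isAdmissible_pair (by omega) (by omega))).le
  have hz2 : ∀ j ∈ Finset.range b, 0 ≤ multipleZeta [a + j, b - j] := fun j hj => by
    have hj' := Finset.mem_range.1 hj
    exact (multipleZeta_pos_of_isAdmissible_holds (MZV.isAdmissible_pair (by omega) (by omega))).le
  have hnn1 : ∀ i ∈ Finset.range a, 0 ≤ (Nat.choose (b + i - 1) i : ℝ) * multipleZeta [b + i, a - i] :=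
    fun i hi => mul_nonneg (Nat.cast_nonneg _) (hz1 i hi)
  have hnn2 : ∀ j ∈ Finset.range b, 0 ≤ (Nat.choose (a + j - 1) j : ℝ) * multipleZeta [a + j, b - j] :=
    fun j hj => mul_nonneg (Nat.cast_nonneg _) (hz2 j hj)
  have hc : ∀ (m : ℕ) (x : ℝ), 0 ≤ x → (m : ℝ≥0∞) * ENNReal.ofReal x = ENNReal.ofReal ((m : ℝ) * x) :=
    fun m x hx => by rw [ENNReal.ofReal_mul (Nat.cast_nonneg _), ENNReal.ofReal_natCast]
  rw [Finset.sum_congr rfl fun i hi => hc _ _ (hz1 i hi),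
    Finset.sum_congr rfl fun j hj => hc _ _ (hz2 j hj),
    ← ENNReal.ofReal_sum_of_nonneg hnn1, ← ENNReal.ofReal_sum_of_nonneg hnn2,
    ← ENNReal.ofReal_mul hpa, ← ENNReal.ofReal_add (Finset.sum_nonneg hnn1) (Finset.sum_nonneg hnn2),
    ENNReal.ofReal_eq_ofReal_iff (mul_nonneg hpa hpb)
      (add_nonneg (Finset.sum_nonneg hnn1) (Finset.sum_nonneg hnn2))] at key
  exact key

/-- Example: `a = b = 2` recovers `ζ(2)² = 2ζ(2,2) + 4ζ(3,1)`. [cite: Eie2013, Theorem 1.2.3] -/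
example : multipleZeta [2] * multipleZeta [2] = 2 * multipleZeta [2, 2] + 4 * multipleZeta [3, 1] := by
  rw [multipleZeta_mul_eq_euler_decomposition le_rfl le_rfl]
  simp [Finset.sum_range_succ, Nat.choose]
  ring

end Literature.NumberTheory.Transcendental
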